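import Mathlib
import Literature.NumberTheory.Irrationality.BrownZudilin2022.BarnesRepresentation
import Summits.KontsevichZagierPeriods.Zeta5Search.BarnesMellin
import Summits.KontsevichZagierPeriods.Zeta5Search.BarnesCube
import Summits.KontsevichZagierPeriods.Zeta5Search.WedgeDictionaryKernel
import Summits.KontsevichZagierPeriods.Zeta5Search.WedgeDictionaryKernelCells
import HarnessLib

/-!
# ζ(5) search — Brown–Zudilin's Barnes-type double integral (16) PROVED: `barnes_double` holds (cell `pub-zeta5`, seat ct-1 g11)

HONEST FRAMING: systematic search; no irrationality claim unless kernel-certified. Nothing in this file is an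
irrationality result, a worthiness exponent or a denominator statement. It DISCHARGES the named Literature fact
`Literature.NumberTheory.Irrationality.BrownZudilin2022.barnes_double` [BrownZudilin2022, Sect. 5, eq. (16)]:
for non-negative integer parameters `(p;q)` and every `(c₁,c₂)` in the `Chamber`, the Barnes kernel is integrable on
the pair of vertical lines and `J(p;q) = q₁!q₂!q₄!q₅!/(p₀!p₆!(p₃+q₃−p₀−p₆)!) · (1/4π²) ∫∫ kernel`.

Route (the paper's, p. 10, with the two `₃F₂`'s left unnamed): open the two denominators of (10) by the
Mellin–Barnes integral for a binomial (`BarnesMellin.mellin_barnes`, twice), exchange the order of integration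
(Fubini on `(0,1)⁵ × ℝ²`, absolute convergence from the exponential decay of `Γ(m+1+s)Γ(−s)` on vertical lines and
the chamber inequalities), and evaluate the inner integral over the cube as a product of five Euler Beta integrals
(`BarnesCube.integral_cube_factor`); the Gamma factors then assemble to the printed kernel and prefactor
(`kernel_identity`). Consequence for the tree: the hypothesis `(hF2 : barnes_double)` of the gen-1 (H1)-free
cellular-relation files `WedgeDictionaryKernel{Cells,Atlas,Trans}*` is dischargeable by `barnes_double_holds`.

Theorems only (no new definitions).
-/

noncomputable section

namespace Summit.KontsevichZagierPeriods.Zeta5Search.BarnesDouble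

open MeasureTheory Set Filter
open scoped Real
open Literature.NumberTheory.Irrationality.BrownZudilin2022
open Summit.KontsevichZagierPeriods.Zeta5Search.CubicalSubstitution (openCube_eq_pi measurableSet_openCube)
open Summit.KontsevichZagierPeriods.Zeta5Search.BarnesMellin
open Summit.KontsevichZagierPeriods.Zeta5Search.BarnesCube
open Summit.KontsevichZagierPeriods.Zeta5Search.WedgeDictionary.Kernel (barnesPrefactor_pos)
open Summit.KontsevichZagierPeriods.Zeta5Search.WedgeDictionary.KernelCells (gamma_int_succ)

/-! ### 1. Assembling the Gamma factors into the printed kernel and prefactor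
(`Γ(z+1) = z!` for integers `z ≥ 0` is the tree's `WedgeDictionary.KernelCells.gamma_int_succ`) -/

/-- **Kernel identity.** The five Beta values times the two Mellin–Barnes weights equal
`barnesPrefactor p q · barnesKernel p q s t`. -/
theorem kernel_identity (p : Fin 7 → ℤ) (q : Fin 5 → ℤ) (hq : ∀ j, 0 ≤ q j)
    {m₀ m₆ : ℕ} (hp0 : p 0 = m₀) (hp6 : p 6 = m₆) {c₁ c₂ : ℝ} (hch : Chamber p q c₁ c₂) (s t : ℂ) :
    (Complex.Gamma ((p 1 : ℂ) + 1 + s) * Complex.Gamma ((q 0 : ℂ) + 1) /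
        Complex.Gamma ((p 1 : ℂ) + (q 0 : ℂ) + 2 + s)) *
    (Complex.Gamma ((p 2 : ℂ) + 1 + s) * Complex.Gamma ((q 1 : ℂ) + 1) /
        Complex.Gamma ((p 2 : ℂ) + (q 1 : ℂ) + 2 + s)) *
    (Complex.Gamma ((p 3 : ℂ) + 2 + s + t) * Complex.Gamma ((q 2 : ℂ) - (p 0 : ℂ) - (p 6 : ℂ) - 1 - s - t) /
        Complex.Gamma ((p 3 : ℂ) + (q 2 : ℂ) - (p 0 : ℂ) - (p 6 : ℂ) + 1)) *
    (Complex.Gamma ((p 4 : ℂ) + 1 + t) * Complex.Gamma ((q 3 : ℂ) + 1) /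
        Complex.Gamma ((p 4 : ℂ) + (q 3 : ℂ) + 2 + t)) *
    (Complex.Gamma ((p 5 : ℂ) + 1 + t) * Complex.Gamma ((q 4 : ℂ) + 1) /
        Complex.Gamma ((p 5 : ℂ) + (q 4 : ℂ) + 2 + t)) *
    ((Complex.Gamma ((m₀ : ℂ) + 1 + s) * Complex.Gamma (-s) / (m₀.factorial : ℂ)) *
      (Complex.Gamma ((m₆ : ℂ) + 1 + t) * Complex.Gamma (-t) / (m₆.factorial : ℂ))) =
    (barnesPrefactor p q : ℂ) * barnesKernel p q s t := by
  obtain ⟨hc1, b0, b1, b2, hc2, b4, b5, b6, hlo, hhi⟩ := chamber_bounds hch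
  have hD : 0 ≤ p 3 + q 2 - p 0 - p 6 := by
    have h' : ((p 0 + p 6 - q 2 - p 3 : ℤ) : ℝ) < 1 := by push_cast; linarith
    have h'' : p 0 + p 6 - q 2 - p 3 < 1 := by exact_mod_cast h'
    omega
  have fD : Complex.Gamma ((p 3 : ℂ) + (q 2 : ℂ) - (p 0 : ℂ) - (p 6 : ℂ) + 1) =
      (((p 3 + q 2 - p 0 - p 6).toNat.factorial : ℕ) : ℂ) := by
    have := gamma_int_succ hD
    push_cast at this
    exact this
  unfold barnesPrefactor barnesKernel
  rw [gamma_int_succ (hq 0), gamma_int_succ (hq 1), gamma_int_succ (hq 3),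
    gamma_int_succ (hq 4), fD]
  have hm0 : (p 0).toNat = m₀ := by rw [hp0, Int.toNat_natCast]
  have hm6 : (p 6).toNat = m₆ := by rw [hp6, Int.toNat_natCast]
  have hp0' : ((p 0 : ℤ) : ℂ) = (m₀ : ℂ) := by rw [hp0, Int.cast_natCast]
  have hp6' : ((p 6 : ℤ) : ℂ) = (m₆ : ℂ) := by rw [hp6, Int.cast_natCast]
  rw [hm0, hm6, hp0', hp6']
  push_cast
  ring

/-! ### 2. Two Mellin–Barnes integrals at once -/

/-- Opening both denominators: for `R ∈ ℝ`, `w₁, w₂ > 0` and `0 < cᵢ < mᵢ+1`,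
`R (1+w₁)^{-(m₀+1)} (1+w₂)^{-(m₆+1)} = (1/2π)² ∫∫_{ℝ²} R · w₁^s w₂^t · G₁(s) G₂(t)`,
`s = −c₁+iy₁`, `t = −c₂+iy₂`, `G(s) = Γ(m+1+s)Γ(−s)/m!` (two copies of `BarnesMellin.mellin_barnes` and Fubini for
a product). -/
theorem mb_pair (m₀ m₆ : ℕ) {c₁ c₂ : ℝ} (hc1 : 0 < c₁) (hc1' : c₁ < m₀ + 1) (hc2 : 0 < c₂) (hc2' : c₂ < m₆ + 1)
    (R : ℝ) {w₁ w₂ : ℝ} (hw1 : 0 < w₁) (hw2 : 0 < w₂) :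
    (((R * (((1 + w₁) ^ (m₀ + 1))⁻¹ * ((1 + w₂) ^ (m₆ + 1))⁻¹)) : ℝ) : ℂ) =
      (1 / (2 * π) : ℂ) ^ 2 * ∫ η : ℝ × ℝ, (R : ℂ) *
        ((w₁ : ℂ) ^ (-(c₁ : ℂ) + (η.1 : ℂ) * Complex.I) * (w₂ : ℂ) ^ (-(c₂ : ℂ) + (η.2 : ℂ) * Complex.I)) *
        ((Complex.Gamma ((m₀ : ℂ) + 1 + (-(c₁ : ℂ) + (η.1 : ℂ) * Complex.I)) *
            Complex.Gamma (-(-(c₁ : ℂ) + (η.1 : ℂ) * Complex.I)) / (m₀.factorial : ℂ)) *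
          (Complex.Gamma ((m₆ : ℂ) + 1 + (-(c₂ : ℂ) + (η.2 : ℂ) * Complex.I)) *
            Complex.Gamma (-(-(c₂ : ℂ) + (η.2 : ℂ) * Complex.I)) / (m₆.factorial : ℂ))) := by
  push_cast
  rw [mellin_barnes m₀ hw1 hc1 hc1', mellin_barnes m₆ hw2 hc2 hc2']
  set f1 : ℝ → ℂ := fun y => (w₁ : ℂ) ^ (-(c₁ : ℂ) + (y : ℂ) * Complex.I) *
        (Complex.Gamma ((m₀ : ℂ) + 1 + (-(c₁ : ℂ) + (y : ℂ) * Complex.I)) *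
          Complex.Gamma (-(-(c₁ : ℂ) + (y : ℂ) * Complex.I)) / (m₀.factorial : ℂ)) with hf1
  set g1 : ℝ → ℂ := fun y => (w₂ : ℂ) ^ (-(c₂ : ℂ) + (y : ℂ) * Complex.I) *
        (Complex.Gamma ((m₆ : ℂ) + 1 + (-(c₂ : ℂ) + (y : ℂ) * Complex.I)) *
          Complex.Gamma (-(-(c₂ : ℂ) + (y : ℂ) * Complex.I)) / (m₆.factorial : ℂ)) with hg1
  have hprod : (∫ y : ℝ, f1 y) * (∫ y : ℝ, g1 y) = ∫ η : ℝ × ℝ, f1 η.1 * g1 η.2 := by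
    rw [Measure.volume_eq_prod, integral_prod_mul]
  have hre : ∫ η : ℝ × ℝ, (R : ℂ) *
        ((w₁ : ℂ) ^ (-(c₁ : ℂ) + (η.1 : ℂ) * Complex.I) * (w₂ : ℂ) ^ (-(c₂ : ℂ) + (η.2 : ℂ) * Complex.I)) *
        ((Complex.Gamma ((m₀ : ℂ) + 1 + (-(c₁ : ℂ) + (η.1 : ℂ) * Complex.I)) *
            Complex.Gamma (-(-(c₁ : ℂ) + (η.1 : ℂ) * Complex.I)) / (m₀.factorial : ℂ)) *
          (Complex.Gamma ((m₆ : ℂ) + 1 + (-(c₂ : ℂ) + (η.2 : ℂ) * Complex.I)) *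
            Complex.Gamma (-(-(c₂ : ℂ) + (η.2 : ℂ) * Complex.I)) / (m₆.factorial : ℂ))) =
      (R : ℂ) * ∫ η : ℝ × ℝ, f1 η.1 * g1 η.2 := by
    rw [← integral_const_mul]
    congr 1
    funext η
    simp only [hf1, hg1]
    ring
  rw [hre, ← hprod]
  ring

/-! ### 3. Absolute convergence of the joint integrand on `(0,1)⁵ × ℝ²` -/

/-- **Fubini input.** After opening both denominators, the joint integrand
`H(y,η) = R(y) · w₁^s w₂^t · G₁(s)G₂(t)` is integrable on `(0,1)⁵ × ℝ²` (for `(c₁,c₂)` in the chamber): its norm is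
the product of the factorised Beta integrand at `η = 0` (integrable on the cube) and of `‖G₁‖‖G₂‖` (integrable on `ℝ²`
by the exponential decay of `Γ` on vertical lines). -/
theorem integrable_joint (p : Fin 7 → ℤ) (q : Fin 5 → ℤ) (hq : ∀ j, 0 ≤ q j) {m₀ m₆ : ℕ}
    (hp0 : p 0 = m₀) (hp6 : p 6 = m₆) {c₁ c₂ : ℝ} (hch : Chamber p q c₁ c₂) :
    Integrable (Function.uncurry fun (y : Fin 5 → ℝ) (η : ℝ × ℝ) =>
      ((y 0 ^ (p 1) * (1 - y 0) ^ (q 0) * y 1 ^ (p 2) * (1 - y 1) ^ (q 1) * y 2 ^ (p 3 + 1) * (1 - y 2) ^ (q 2) *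
          y 3 ^ (p 4) * (1 - y 3) ^ (q 3) * y 4 ^ (p 5) * (1 - y 4) ^ (q 4) /
          ((1 - y 2) ^ (m₀ + 1) * (1 - y 2) ^ (m₆ + 1)) : ℝ) : ℂ) *
      ((((y 2 * (y 0 * y 1) / (1 - y 2) : ℝ)) : ℂ) ^ (-(c₁ : ℂ) + (η.1 : ℂ) * Complex.I) *
        (((y 2 * (y 3 * y 4) / (1 - y 2) : ℝ)) : ℂ) ^ (-(c₂ : ℂ) + (η.2 : ℂ) * Complex.I)) *
      ((Complex.Gamma ((m₀ : ℂ) + 1 + (-(c₁ : ℂ) + (η.1 : ℂ) * Complex.I)) *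
          Complex.Gamma (-(-(c₁ : ℂ) + (η.1 : ℂ) * Complex.I)) / (m₀.factorial : ℂ)) *
        (Complex.Gamma ((m₆ : ℂ) + 1 + (-(c₂ : ℂ) + (η.2 : ℂ) * Complex.I)) *
          Complex.Gamma (-(-(c₂ : ℂ) + (η.2 : ℂ) * Complex.I)) / (m₆.factorial : ℂ))))
      (((volume : Measure (Fin 5 → ℝ)).restrict openCube).prod (volume : Measure (ℝ × ℝ))) := by
  obtain ⟨hc1, b0, b1, b2, hc2, b4, b5, b6, hlo, hhi⟩ := chamber_bounds hch
  have hc1' : c₁ < (m₀ : ℝ) + 1 := by rw [hp0] at b0; push_cast at b0; linarith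
  have hc2' : c₂ < (m₆ : ℝ) + 1 := by rw [hp6] at b6; push_cast at b6; linarith
  -- (a) measurability
  have hRm : Measurable fun y : Fin 5 → ℝ =>
      y 0 ^ (p 1) * (1 - y 0) ^ (q 0) * y 1 ^ (p 2) * (1 - y 1) ^ (q 1) * y 2 ^ (p 3 + 1) * (1 - y 2) ^ (q 2) *
          y 3 ^ (p 4) * (1 - y 3) ^ (q 3) * y 4 ^ (p 5) * (1 - y 4) ^ (q 4) /
          ((1 - y 2) ^ (m₀ + 1) * (1 - y 2) ^ (m₆ + 1)) := by fun_prop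
  have hW1m : Measurable fun y : Fin 5 → ℝ => y 2 * (y 0 * y 1) / (1 - y 2) := by fun_prop
  have hW2m : Measurable fun y : Fin 5 → ℝ => y 2 * (y 3 * y 4) / (1 - y 2) := by fun_prop
  have hG1m : Measurable fun y₁ : ℝ => Complex.Gamma ((m₀ : ℂ) + 1 + (-(c₁ : ℂ) + (y₁ : ℂ) * Complex.I)) *
      Complex.Gamma (-(-(c₁ : ℂ) + (y₁ : ℂ) * Complex.I)) / (m₀.factorial : ℂ) :=
    ((continuous_Gamma_vertical' m₀ hc1 hc1').div_const _).measurable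
  have hG2m : Measurable fun y₂ : ℝ => Complex.Gamma ((m₆ : ℂ) + 1 + (-(c₂ : ℂ) + (y₂ : ℂ) * Complex.I)) *
      Complex.Gamma (-(-(c₂ : ℂ) + (y₂ : ℂ) * Complex.I)) / (m₆.factorial : ℂ) :=
    ((continuous_Gamma_vertical' m₆ hc2 hc2').div_const _).measurable
  have hs1 : Measurable fun z : (Fin 5 → ℝ) × (ℝ × ℝ) => -(c₁ : ℂ) + (z.2.1 : ℂ) * Complex.I := by fun_prop
  have hs2 : Measurable fun z : (Fin 5 → ℝ) × (ℝ × ℝ) => -(c₂ : ℂ) + (z.2.2 : ℂ) * Complex.I := by fun_prop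
  have hmeas : Measurable (Function.uncurry fun (y : Fin 5 → ℝ) (η : ℝ × ℝ) =>
      ((y 0 ^ (p 1) * (1 - y 0) ^ (q 0) * y 1 ^ (p 2) * (1 - y 1) ^ (q 1) * y 2 ^ (p 3 + 1) * (1 - y 2) ^ (q 2) *
          y 3 ^ (p 4) * (1 - y 3) ^ (q 3) * y 4 ^ (p 5) * (1 - y 4) ^ (q 4) /
          ((1 - y 2) ^ (m₀ + 1) * (1 - y 2) ^ (m₆ + 1)) : ℝ) : ℂ) *
      ((((y 2 * (y 0 * y 1) / (1 - y 2) : ℝ)) : ℂ) ^ (-(c₁ : ℂ) + (η.1 : ℂ) * Complex.I) *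
        (((y 2 * (y 3 * y 4) / (1 - y 2) : ℝ)) : ℂ) ^ (-(c₂ : ℂ) + (η.2 : ℂ) * Complex.I)) *
      ((Complex.Gamma ((m₀ : ℂ) + 1 + (-(c₁ : ℂ) + (η.1 : ℂ) * Complex.I)) *
          Complex.Gamma (-(-(c₁ : ℂ) + (η.1 : ℂ) * Complex.I)) / (m₀.factorial : ℂ)) *
        (Complex.Gamma ((m₆ : ℂ) + 1 + (-(c₂ : ℂ) + (η.2 : ℂ) * Complex.I)) *
          Complex.Gamma (-(-(c₂ : ℂ) + (η.2 : ℂ) * Complex.I)) / (m₆.factorial : ℂ)))) :=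
    ((Complex.measurable_ofReal.comp (hRm.comp measurable_fst)).mul
      (((Complex.measurable_ofReal.comp (hW1m.comp measurable_fst)).pow hs1).mul
        ((Complex.measurable_ofReal.comp (hW2m.comp measurable_fst)).pow hs2))).mul
      ((hG1m.comp (measurable_fst.comp measurable_snd)).mul (hG2m.comp (measurable_snd.comp measurable_snd)))
  -- (b) domination by a product of integrable functions
  have hΦ := (integrableOn_cube_factor p q hq hch 0 0).norm
  have hΨ : Integrable (fun η : ℝ × ℝ => ‖Complex.Gamma ((m₀ : ℂ) + 1 + (-(c₁ : ℂ) + (η.1 : ℂ) * Complex.I)) *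
      Complex.Gamma (-(-(c₁ : ℂ) + (η.1 : ℂ) * Complex.I)) / (m₀.factorial : ℂ)‖ *
      ‖Complex.Gamma ((m₆ : ℂ) + 1 + (-(c₂ : ℂ) + (η.2 : ℂ) * Complex.I)) *
      Complex.Gamma (-(-(c₂ : ℂ) + (η.2 : ℂ) * Complex.I)) / (m₆.factorial : ℂ)‖) := by
    have h1 := ((integrable_Gamma_vertical' m₀ hc1 hc1').div_const (m₀.factorial : ℂ)).norm
    have h2 := ((integrable_Gamma_vertical' m₆ hc2 hc2').div_const (m₆.factorial : ℂ)).norm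
    rw [Measure.volume_eq_prod]
    exact h1.mul_prod h2
  refine Integrable.mono' (hΦ.mul_prod hΨ) hmeas.aestronglyMeasurable ?_
  have hμ : (((volume : Measure (Fin 5 → ℝ)).restrict openCube).prod (volume : Measure (ℝ × ℝ))) =
      ((volume : Measure (Fin 5 → ℝ)).prod (volume : Measure (ℝ × ℝ))).restrict (openCube ×ˢ univ) := by
    rw [← Measure.prod_restrict, Measure.restrict_univ]
  rw [hμ]
  refine ae_restrict_of_forall_mem (measurableSet_openCube.prod MeasurableSet.univ) ?_
  rintro ⟨y, η⟩ ⟨hy, -⟩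
  have h0 := (hy 0).1; have h1 := (hy 1).1; have h2 := (hy 2).1; have h3 := (hy 3).1; have h4 := (hy 4).1
  have h2' : 0 < 1 - y 2 := by linarith [(hy 2).2]
  have hw1 : 0 < y 2 * (y 0 * y 1) / (1 - y 2) := by positivity
  have hw2 : 0 < y 2 * (y 3 * y 4) / (1 - y 2) := by positivity
  simp only [Function.uncurry_apply_pair]
  rw [← cube_factorisation p q hp0 hp6 (-(c₁ : ℂ) + ((0:ℝ) : ℂ) * Complex.I) (-(c₂ : ℂ) + ((0:ℝ) : ℂ) * Complex.I) hy]
  simp only [norm_mul, Complex.norm_cpow_eq_rpow_re_of_pos hw1, Complex.norm_cpow_eq_rpow_re_of_pos hw2]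
  simp

/-! ### 4. The theorem -/

/-- The inner (cube) integral of `H(·, η)` is `barnesPrefactor p q · barnesKernel p q s t`. -/
theorem inner_integral (p : Fin 7 → ℤ) (q : Fin 5 → ℤ) (hq : ∀ j, 0 ≤ q j) {m₀ m₆ : ℕ}
    (hp0 : p 0 = m₀) (hp6 : p 6 = m₆) {c₁ c₂ : ℝ} (hch : Chamber p q c₁ c₂) (η : ℝ × ℝ) :
    ∫ y in openCube, ((y 0 ^ (p 1) * (1 - y 0) ^ (q 0) * y 1 ^ (p 2) * (1 - y 1) ^ (q 1) * y 2 ^ (p 3 + 1) * (1 - y 2) ^ (q 2) *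
          y 3 ^ (p 4) * (1 - y 3) ^ (q 3) * y 4 ^ (p 5) * (1 - y 4) ^ (q 4) /
          ((1 - y 2) ^ (m₀ + 1) * (1 - y 2) ^ (m₆ + 1)) : ℝ) : ℂ) *
      ((((y 2 * (y 0 * y 1) / (1 - y 2) : ℝ)) : ℂ) ^ (-(c₁ : ℂ) + (η.1 : ℂ) * Complex.I) *
        (((y 2 * (y 3 * y 4) / (1 - y 2) : ℝ)) : ℂ) ^ (-(c₂ : ℂ) + (η.2 : ℂ) * Complex.I)) *
      ((Complex.Gamma ((m₀ : ℂ) + 1 + (-(c₁ : ℂ) + (η.1 : ℂ) * Complex.I)) *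
          Complex.Gamma (-(-(c₁ : ℂ) + (η.1 : ℂ) * Complex.I)) / (m₀.factorial : ℂ)) *
        (Complex.Gamma ((m₆ : ℂ) + 1 + (-(c₂ : ℂ) + (η.2 : ℂ) * Complex.I)) *
          Complex.Gamma (-(-(c₂ : ℂ) + (η.2 : ℂ) * Complex.I)) / (m₆.factorial : ℂ))) =
      (barnesPrefactor p q : ℂ) * barnesKernel p q (-(c₁ : ℂ) + (η.1 : ℂ) * Complex.I) (-(c₂ : ℂ) + (η.2 : ℂ) * Complex.I) := by
  have hpt : ∀ y ∈ openCube, ((y 0 ^ (p 1) * (1 - y 0) ^ (q 0) * y 1 ^ (p 2) * (1 - y 1) ^ (q 1) * y 2 ^ (p 3 + 1) * (1 - y 2) ^ (q 2) *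
          y 3 ^ (p 4) * (1 - y 3) ^ (q 3) * y 4 ^ (p 5) * (1 - y 4) ^ (q 4) /
          ((1 - y 2) ^ (m₀ + 1) * (1 - y 2) ^ (m₆ + 1)) : ℝ) : ℂ) *
      ((((y 2 * (y 0 * y 1) / (1 - y 2) : ℝ)) : ℂ) ^ (-(c₁ : ℂ) + (η.1 : ℂ) * Complex.I) *
        (((y 2 * (y 3 * y 4) / (1 - y 2) : ℝ)) : ℂ) ^ (-(c₂ : ℂ) + (η.2 : ℂ) * Complex.I)) *
      ((Complex.Gamma ((m₀ : ℂ) + 1 + (-(c₁ : ℂ) + (η.1 : ℂ) * Complex.I)) *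
          Complex.Gamma (-(-(c₁ : ℂ) + (η.1 : ℂ) * Complex.I)) / (m₀.factorial : ℂ)) *
        (Complex.Gamma ((m₆ : ℂ) + 1 + (-(c₂ : ℂ) + (η.2 : ℂ) * Complex.I)) *
          Complex.Gamma (-(-(c₂ : ℂ) + (η.2 : ℂ) * Complex.I)) / (m₆.factorial : ℂ))) =
      (((y 0 : ℂ) ^ ((p 1 : ℂ) + (-(c₁ : ℂ) + (η.1 : ℂ) * Complex.I)) * (1 - (y 0 : ℂ)) ^ ((q 0 : ℂ))) *
      ((y 1 : ℂ) ^ ((p 2 : ℂ) + (-(c₁ : ℂ) + (η.1 : ℂ) * Complex.I)) * (1 - (y 1 : ℂ)) ^ ((q 1 : ℂ))) *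
      ((y 2 : ℂ) ^ ((p 3 : ℂ) + 1 + (-(c₁ : ℂ) + (η.1 : ℂ) * Complex.I) + (-(c₂ : ℂ) + (η.2 : ℂ) * Complex.I)) *
        (1 - (y 2 : ℂ)) ^ ((q 2 : ℂ) - (p 0 : ℂ) - (p 6 : ℂ) - 2 - (-(c₁ : ℂ) + (η.1 : ℂ) * Complex.I) - (-(c₂ : ℂ) + (η.2 : ℂ) * Complex.I))) *
      ((y 3 : ℂ) ^ ((p 4 : ℂ) + (-(c₂ : ℂ) + (η.2 : ℂ) * Complex.I)) * (1 - (y 3 : ℂ)) ^ ((q 3 : ℂ))) *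
      ((y 4 : ℂ) ^ ((p 5 : ℂ) + (-(c₂ : ℂ) + (η.2 : ℂ) * Complex.I)) * (1 - (y 4 : ℂ)) ^ ((q 4 : ℂ)))) *
      ((Complex.Gamma ((m₀ : ℂ) + 1 + (-(c₁ : ℂ) + (η.1 : ℂ) * Complex.I)) *
          Complex.Gamma (-(-(c₁ : ℂ) + (η.1 : ℂ) * Complex.I)) / (m₀.factorial : ℂ)) *
        (Complex.Gamma ((m₆ : ℂ) + 1 + (-(c₂ : ℂ) + (η.2 : ℂ) * Complex.I)) *
          Complex.Gamma (-(-(c₂ : ℂ) + (η.2 : ℂ) * Complex.I)) / (m₆.factorial : ℂ))) := by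
    intro y hy
    rw [cube_factorisation p q hp0 hp6 _ _ hy]
  rw [setIntegral_congr_fun measurableSet_openCube hpt, integral_mul_const,
    integral_cube_factor p q hq hch η.1 η.2, kernel_identity p q hq hp0 hp6 hch]

/-- **Brown–Zudilin (16) holds**: the named fact `barnes_double` of `BarnesRepresentation.lean` is a theorem —
for `p, q ≥ 0` and `(c₁,c₂)` in the chamber, the Barnes kernel is integrable on `Re s = −c₁`, `Re t = −c₂` and
`J(p;q) = q₁!q₂!q₄!q₅!/(p₀!p₆!(p₃+q₃−p₀−p₆)!) · (1/4π²) ∫∫ barnesKernel p q (−c₁+iy₁) (−c₂+iy₂) dy₁dy₂`.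
[BrownZudilin2022, Sect. 5, eq. (16)] -/
theorem barnes_double_holds : barnes_double := by
  intro p q c₁ c₂ hp hq hch
  obtain ⟨hc1, b0, b1, b2, hc2, b4, b5, b6, hlo, hhi⟩ := chamber_bounds hch
  obtain ⟨m₀, hp0⟩ := Int.eq_ofNat_of_zero_le (hp 0)
  obtain ⟨m₆, hp6⟩ := Int.eq_ofNat_of_zero_le (hp 6)
  have hc1' : c₁ < (m₀ : ℝ) + 1 := by rw [hp0] at b0; push_cast at b0; linarith
  have hc2' : c₂ < (m₆ : ℝ) + 1 := by rw [hp6] at b6; push_cast at b6; linarith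
  have hInt := integrable_joint p q hq hp0 hp6 hch
  have hK : (barnesPrefactor p q : ℂ) ≠ 0 := by exact_mod_cast (barnesPrefactor_pos p q).ne'
  refine ⟨?_, ?_⟩
  · -- integrability of the kernel on the contour: a Fubini marginal of the joint integrand
    have h1 := hInt.integral_prod_right
    have h2 : Integrable (fun η : ℝ × ℝ => (barnesPrefactor p q : ℂ) *
        barnesKernel p q (-(c₁ : ℂ) + (η.1 : ℂ) * Complex.I) (-(c₂ : ℂ) + (η.2 : ℂ) * Complex.I)) := by
      refine h1.congr (Eventually.of_forall fun η => ?_)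
      simp only [Function.uncurry_apply_pair]
      exact inner_integral p q hq hp0 hp6 hch η
    refine (h2.const_mul ((barnesPrefactor p q : ℂ)⁻¹)).congr (Eventually.of_forall fun η => ?_)
    simp only
    rw [← mul_assoc, inv_mul_cancel₀ hK, one_mul]
  · -- the identity
    have e1 : (Jintegral p q : ℂ) = ∫ y in openCube, (integrandJ p q y : ℂ) := by
      rw [Jintegral]; exact integral_ofReal.symm
    have step1 : ∀ y ∈ openCube, (integrandJ p q y : ℂ) = (1 / (2 * π) : ℂ) ^ 2 * ∫ η : ℝ × ℝ,
        ((y 0 ^ (p 1) * (1 - y 0) ^ (q 0) * y 1 ^ (p 2) * (1 - y 1) ^ (q 1) * y 2 ^ (p 3 + 1) * (1 - y 2) ^ (q 2) *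
          y 3 ^ (p 4) * (1 - y 3) ^ (q 3) * y 4 ^ (p 5) * (1 - y 4) ^ (q 4) /
          ((1 - y 2) ^ (m₀ + 1) * (1 - y 2) ^ (m₆ + 1)) : ℝ) : ℂ) *
      ((((y 2 * (y 0 * y 1) / (1 - y 2) : ℝ)) : ℂ) ^ (-(c₁ : ℂ) + (η.1 : ℂ) * Complex.I) *
        (((y 2 * (y 3 * y 4) / (1 - y 2) : ℝ)) : ℂ) ^ (-(c₂ : ℂ) + (η.2 : ℂ) * Complex.I)) *
      ((Complex.Gamma ((m₀ : ℂ) + 1 + (-(c₁ : ℂ) + (η.1 : ℂ) * Complex.I)) *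
          Complex.Gamma (-(-(c₁ : ℂ) + (η.1 : ℂ) * Complex.I)) / (m₀.factorial : ℂ)) *
        (Complex.Gamma ((m₆ : ℂ) + 1 + (-(c₂ : ℂ) + (η.2 : ℂ) * Complex.I)) *
          Complex.Gamma (-(-(c₂ : ℂ) + (η.2 : ℂ) * Complex.I)) / (m₆.factorial : ℂ))) := by
      intro y hy
      have h0 := (hy 0).1; have h1 := (hy 1).1; have h2 := (hy 2).1; have h3 := (hy 3).1; have h4 := (hy 4).1
      have h2' : 0 < 1 - y 2 := by linarith [(hy 2).2]
      have hw1 : 0 < y 2 * (y 0 * y 1) / (1 - y 2) := by positivity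
      have hw2 : 0 < y 2 * (y 3 * y 4) / (1 - y 2) := by positivity
      rw [integrandJ_eq_factor p q hp0 hp6 hy]
      exact mb_pair m₀ m₆ hc1 hc1' hc2 hc2' _ hw1 hw2
    have e2 := setIntegral_congr_fun (μ := (volume : Measure (Fin 5 → ℝ))) measurableSet_openCube step1
    have e3 : ∫ y in openCube, (1 / (2 * π) : ℂ) ^ 2 * ∫ η : ℝ × ℝ,
        ((y 0 ^ (p 1) * (1 - y 0) ^ (q 0) * y 1 ^ (p 2) * (1 - y 1) ^ (q 1) * y 2 ^ (p 3 + 1) * (1 - y 2) ^ (q 2) *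
          y 3 ^ (p 4) * (1 - y 3) ^ (q 3) * y 4 ^ (p 5) * (1 - y 4) ^ (q 4) /
          ((1 - y 2) ^ (m₀ + 1) * (1 - y 2) ^ (m₆ + 1)) : ℝ) : ℂ) *
      ((((y 2 * (y 0 * y 1) / (1 - y 2) : ℝ)) : ℂ) ^ (-(c₁ : ℂ) + (η.1 : ℂ) * Complex.I) *
        (((y 2 * (y 3 * y 4) / (1 - y 2) : ℝ)) : ℂ) ^ (-(c₂ : ℂ) + (η.2 : ℂ) * Complex.I)) *
      ((Complex.Gamma ((m₀ : ℂ) + 1 + (-(c₁ : ℂ) + (η.1 : ℂ) * Complex.I)) *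
          Complex.Gamma (-(-(c₁ : ℂ) + (η.1 : ℂ) * Complex.I)) / (m₀.factorial : ℂ)) *
        (Complex.Gamma ((m₆ : ℂ) + 1 + (-(c₂ : ℂ) + (η.2 : ℂ) * Complex.I)) *
          Complex.Gamma (-(-(c₂ : ℂ) + (η.2 : ℂ) * Complex.I)) / (m₆.factorial : ℂ))) =
        (1 / (2 * π) : ℂ) ^ 2 * ((barnesPrefactor p q : ℂ) * ∫ η : ℝ × ℝ,
          barnesKernel p q (-(c₁ : ℂ) + (η.1 : ℂ) * Complex.I) (-(c₂ : ℂ) + (η.2 : ℂ) * Complex.I)) := by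
      rw [integral_const_mul, integral_integral_swap hInt, ← integral_const_mul (barnesPrefactor p q : ℂ)]
      congr 1
      refine integral_congr_ae (Eventually.of_forall fun η => ?_)
      exact inner_integral p q hq hp0 hp6 hch η
    rw [e1, e2, e3]
    set X := ∫ η : ℝ × ℝ, barnesKernel p q (-(c₁ : ℂ) + (η.1 : ℂ) * Complex.I) (-(c₂ : ℂ) + (η.2 : ℂ) * Complex.I)
    have hπ : (Real.pi : ℂ) ≠ 0 := by exact_mod_cast Real.pi_ne_zero
    field_simp
    ring

end Summit.KontsevichZagierPeriods.Zeta5Search.BarnesDouble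

end
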